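import Literature.Topology.PlaneTopology.JordanNesting
import HarnessLib

/-!
# A Jordan curve winds once around the points of its inside

Topic: Topology / PlaneTopology, sequel to `WindingNumber.lean`, `JordanSweepParity.lean` (inside
and outside of a Jordan loop read on winding numbers: `wind ≠ 0` inside, `= 0` outside) and
`JordanNesting.lean`. We sharpen "`≠ 0`" to the classical statement: **the winding number of a
Jordan loop about a point of its inside is `±1`** (`IsJordanLoop.wind_eq_one_or_neg_one_of_mem_inside`).

Proof (roots of the loop). Translate the point to `0` and let `w ≠ 0` be the winding number,
`m = |w|`. A continuous logarithm `l` of `γ` on `[0, 1]` gains `2πi w`, so `V = exp (l / m)` closes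
up: its periodisation `δ` is a loop with `δ ^ m = γ`; it is again a Jordan loop, winding `±1`
times about `0`, so `0` is inside `δ`. The rotated loop `ζ δ` (`ζ = e^{2πi/m}`) is a Jordan loop
with the same `m`-th power, hence **disjoint** from `δ` when `m ≥ 2` (a common point would force
`ζ = 1`), and `0` is inside it as well. Of two disjoint Jordan loops one lies inside the other or
they are mutually exterior (`trichotomy`); the last is excluded since both insides contain `0`,
and the first two are excluded because both loops reach the same maximal distance from `0`, while
**points of the inside are strictly closer to `0` than the farthest point of the loop**
(`IsJordanLoop.norm_lt_of_mem_inside`: farther points are outside, and a boundary point of the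
outside off the curve is outside). Hence `m = 1`.

* `IsJordanLoop.norm_lt_of_mem_inside` (**proved**);
* `IsJordanLoop.wind_eq_one_or_neg_one_of_zero_mem_inside`,
  `IsJordanLoop.wind_eq_one_or_neg_one_of_mem_inside` (**proved**).

All statements are [folklore] (e.g. the degree of a Jordan curve about its interior; the root
trick is the one of the squaring argument of `JordanSweepParity.lean`).
-/

noncomputable section

open Set Filter Function Metric Complex Bornology
open _root_.Topology
open scoped Real

namespace Literature.Topology.PlaneTopology

namespace IsJordanLoop

variable {γ : ℝ → ℂ}

/-! ## Points of the inside are strictly closer than the farthest point of the loop -/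

/-- **Points of the inside of a Jordan loop are strictly closer to the origin than a bound of the
loop**: if `‖γ t‖ ≤ R` for all `t` and `z` is inside, then `‖z‖ < R`. [folklore] -/
theorem norm_lt_of_mem_inside (h : IsJordanLoop γ) {R : ℝ} (hR : ∀ t, ‖γ t‖ ≤ R) {z : ℂ} (hz : z ∈ inside γ) :
    ‖z‖ < R := by
  by_contra hge
  rw [not_lt] at hge
  have hrange : range γ ⊆ closedBall (0 : ℂ) R := by
    rintro _ ⟨t, rfl⟩; exact mem_closedBall_zero_iff.2 (hR t)
  -- `z ≠ 0`: otherwise the loop is identically `0` and passes through `z`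
  have hz0 : z ≠ 0 := by
    intro h0
    rw [h0, norm_zero] at hge
    have hγ0 : γ 0 = 0 := norm_le_zero_iff.1 ((hR 0).trans hge)
    exact hz.1 ⟨0, by rw [hγ0, h0]⟩
  -- the points `(1 + ε) z`, `ε > 0`, are outside, and tend to `z`
  have hout : ∀ ε : ℝ, 0 < ε → ((1 + ε : ℝ) : ℂ) * z ∈ outside γ := fun ε hε ↦ by
    refine mem_outside_of_lt_norm hrange ?_
    rw [norm_mul, Complex.norm_real, Real.norm_eq_abs, abs_of_pos (by linarith)]
    have hzpos : 0 < ‖z‖ := norm_pos_iff.2 hz0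
    nlinarith
  have htend : Tendsto (fun ε : ℝ ↦ ((1 + ε : ℝ) : ℂ) * z) (𝓝[>] 0) (𝓝 z) := by
    have hc : Continuous fun ε : ℝ ↦ ((1 + ε : ℝ) : ℂ) * z := by fun_prop
    have h := hc.continuousAt (x := 0)
    simp only [ContinuousAt, add_zero, ofReal_one, one_mul] at h
    exact h.mono_left nhdsWithin_le_nhds
  have hcl : z ∈ closure (outside γ) :=
    mem_closure_of_tendsto htend (eventually_nhdsWithin_of_forall fun ε hε ↦ hout ε hε)
  rw [h.closure_outside_eq] at hcl
  rcases hcl with hzo | hzr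
  · exact Set.disjoint_left.1 disjoint_inside_outside hz hzo
  · exact hz.1 hzr

/-! ## The winding number about inside points is `±1` -/

/-- A `1`-periodic function is determined by its values at fractional parts. [folklore] -/
private theorem periodic_map_fract' {δ : ℝ → ℂ} (hδ : Function.Periodic δ 1) (t : ℝ) : δ (Int.fract t) = δ t := by
  rw [Int.fract, show t - (⌊t⌋ : ℝ) = t - (⌊t⌋ : ℤ) * (1 : ℝ) by ring]
  exact hδ.sub_int_mul_eq ⌊t⌋

/-- `2πi ≠ 0`. [folklore] -/
private theorem two_pi_I_ne_zero'' : (2 * π * I : ℂ) ≠ 0 := by simp [Real.pi_ne_zero, I_ne_zero]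

/-- **A Jordan loop winds `±1` times about the origin when the origin is inside.** [folklore] -/
theorem wind_eq_one_or_neg_one_of_zero_mem_inside (h : IsJordanLoop γ) (h0 : (0 : ℂ) ∈ inside γ) :
    wind γ = 1 ∨ wind γ = -1 := by
  have h0r : (0 : ℂ) ∉ range γ := h0.1
  have hne : ∀ t, γ t ≠ 0 := fun t ht ↦ h0r ⟨t, ht⟩
  -- the winding number is non-zero
  have hw : wind γ ≠ 0 := by
    have h := (h.mem_inside_iff_wind_ne_zero h0r).1 h0
    simpa only [sub_zero] using h
  set w : ℤ := wind γ with hw_def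
  set m : ℕ := w.natAbs with hm_def
  have hm0 : m ≠ 0 := Int.natAbs_ne_zero.2 hw
  have hmpos : 0 < (m : ℝ) := by exact_mod_cast Nat.pos_of_ne_zero hm0
  have hmC : (m : ℂ) ≠ 0 := by exact_mod_cast hm0
  -- it suffices to exclude `m ≥ 2`
  suffices hm1 : m = 1 by
    rcases Int.natAbs_eq w with hw' | hw'
    · left; rw [hw', ← hm_def, hm1]; rfl
    · right; rw [hw', ← hm_def, hm1]; rfl
  by_contra hm1
  have hm2 : 2 ≤ m := by omega
  /- Step 1: a continuous logarithm and the `m`-th root loop -/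
  have hnv : IsNonvanishingLoop γ := ⟨h.continuous.continuousOn, fun t _ ↦ hne t, h.eq_zero_one⟩
  obtain ⟨l, hl, hle⟩ := hnv.hasLogOn
  have hspec : l 1 - l 0 = w * (2 * π * I) := wind_spec hl hle h.eq_zero_one
  have hwm : (w : ℂ) = m ∨ (w : ℂ) = -m := by
    rcases Int.natAbs_eq w with hw' | hw'
    · left; rw [hw', ← hm_def]; simp
    · right; rw [hw', ← hm_def]; simp
  set V : ℝ → ℂ := fun t ↦ exp (l t / m) with hV
  have hVc : ContinuousOn V (Icc 0 1) := Complex.continuous_exp.comp_continuousOn (hl.div_const _)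
  have hV0 : ∀ s, V s ≠ 0 := fun s ↦ exp_ne_zero _
  have hVpow : ∀ t ∈ Icc (0 : ℝ) 1, V t ^ m = γ t := fun t ht ↦ by
    show exp (l t / m) ^ m = γ t
    rw [← Complex.exp_nat_mul, mul_div_cancel₀ _ hmC, hle t ht]
  have hV01 : V 0 = V 1 := by
    show exp (l 0 / m) = exp (l 1 / m)
    have h1 : l 1 = l 0 + w * (2 * π * I) := by rw [← hspec]; ring
    rw [h1, add_div, Complex.exp_add]
    suffices hk : exp (w * (2 * π * I) / m) = 1 by rw [hk, mul_one]
    rcases hwm with hw' | hw'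
    · rw [hw', mul_div_cancel_left₀ _ hmC, Complex.exp_two_pi_mul_I]
    · rw [hw', neg_mul, neg_div, mul_div_cancel_left₀ _ hmC, Complex.exp_neg, Complex.exp_two_pi_mul_I, inv_one]
  set δ : ℝ → ℂ := V ∘ Int.fract with hδ
  have hδV : ∀ t ∈ Icc (0 : ℝ) 1, δ t = V t := fun t ht ↦ comp_fract_apply_of_mem_Icc hV01 ht
  have hδpow : ∀ t, δ t ^ m = γ t := fun t ↦ by
    show V (Int.fract t) ^ m = γ t
    rw [hVpow _ (fract_mem_Icc t), periodic_map_fract' h.periodic]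
  have hδ0 : ∀ t, δ t ≠ 0 := fun t ↦ hV0 _
  -- `γ s = γ t` forces `δ s = δ t`
  have hδinj : ∀ s t, γ s = γ t → δ s = δ t := fun s t hst ↦ by
    rw [← periodic_map_fract' h.periodic s, ← periodic_map_fract' h.periodic t] at hst
    have := h.injOn ⟨Int.fract_nonneg s, Int.fract_lt_one s⟩ ⟨Int.fract_nonneg t, Int.fract_lt_one t⟩ hst
    show V (Int.fract s) = V (Int.fract t)
    rw [this]
  /- Step 2: `δ` is a Jordan loop with `0` inside -/
  have hδJ : IsJordanLoop δ := by
    refine ⟨hVc.comp_fract'' hV01, periodic_comp_fract, fun s hs t ht hst ↦ ?_⟩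
    have h2 : γ s = γ t := by rw [← hδpow s, ← hδpow t, hst]
    exact h.injOn hs ht h2
  have hδ0r : (0 : ℂ) ∉ range δ := by rintro ⟨t, ht⟩; exact hδ0 t ht
  have hδwind : wind δ ≠ 0 := by
    intro hzero
    have hl' : ContinuousOn (fun t ↦ l t / m) (Icc 0 1) := hl.div_const _
    have hle' : ∀ t ∈ Icc (0 : ℝ) 1, exp (l t / m) = δ t := fun t ht ↦ by rw [hδV t ht]
    have hsp := wind_spec hl' hle' hδJ.eq_zero_one
    rw [hzero, Int.cast_zero, zero_mul, ← sub_div, hspec, div_eq_zero_iff] at hsp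
    rcases hsp with hsp | hsp
    · exact hw (by exact_mod_cast (mul_eq_zero.1 hsp).resolve_right two_pi_I_ne_zero'')
    · exact hmC hsp
  have hδin : (0 : ℂ) ∈ inside δ := (hδJ.mem_inside_iff_wind_ne_zero hδ0r).2 (by simpa only [sub_zero] using hδwind)
  /- Step 3: the rotated loop -/
  set ζ : ℂ := exp (2 * π * I / m) with hζ
  have hζ0 : ζ ≠ 0 := exp_ne_zero _
  have hζpow : ζ ^ m = 1 := by rw [hζ, ← Complex.exp_nat_mul, mul_div_cancel₀ _ hmC, Complex.exp_two_pi_mul_I]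
  have hζ1 : ζ ≠ 1 := by
    intro h1
    obtain ⟨k, hk⟩ := Complex.exp_eq_one_iff.1 h1
    have hk' : (k : ℂ) * m = 1 := by
      have h2 : (2 * π * I : ℂ) = (k * m) * (2 * π * I) := by
        calc (2 * π * I : ℂ) = (2 * π * I / m) * m := (div_mul_cancel₀ _ hmC).symm
          _ = k * (2 * π * I) * m := by rw [hk]
          _ = (k * m) * (2 * π * I) := by ring
      exact mul_right_cancel₀ two_pi_I_ne_zero'' (h2.symm.trans (one_mul _).symm)
    have hkm : k * m = 1 := by exact_mod_cast hk'
    have hm1' : (m : ℤ) = 1 := Int.eq_one_of_mul_eq_one_left (by exact_mod_cast (Nat.zero_le m)) hkm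
    omega
  have hζnorm : ‖ζ‖ = 1 := by
    rw [hζ, show (2 * π * I / m : ℂ) = ((2 * π / m : ℝ) : ℂ) * I by push_cast; ring, Complex.norm_exp_ofReal_mul_I]
  set φ : ℂ ≃ₜ ℂ := Homeomorph.mulLeft₀ ζ hζ0 with hφ
  have hφδ : (φ ∘ δ : ℝ → ℂ) = fun t ↦ ζ * δ t := rfl
  have hδ'J : IsJordanLoop (fun t ↦ ζ * δ t) := hφδ ▸ hδJ.comp_homeomorph φ
  have hδ'in : (0 : ℂ) ∈ inside (fun t ↦ ζ * δ t) := by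
    have h := (hδJ.mem_inside_comp_homeomorph_iff φ (z := 0)).2 hδin
    rwa [hφδ, show φ 0 = 0 from mul_zero ζ] at h
  -- the two loops are disjoint
  have hdisj : Disjoint (range δ) (range fun t ↦ ζ * δ t) := by
    rw [Set.disjoint_left]
    rintro _ ⟨s, rfl⟩ ⟨t, ht⟩
    -- `ζ δ t = δ s`
    have ht' : ζ * δ t = δ s := ht
    have hγ : γ t = γ s := by
      rw [← hδpow t, ← hδpow s, ← ht', mul_pow, hζpow, one_mul]
    have hδeq : δ t = δ s := hδinj t s hγ
    rw [hδeq] at ht'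
    have : (ζ - 1) * δ s = 0 := by rw [sub_mul, one_mul, ht', sub_self]
    rcases mul_eq_zero.1 this with h1 | h1
    · exact hζ1 (sub_eq_zero.1 h1)
    · exact hδ0 s h1
  /- Step 4: both loops reach the same maximal distance from `0` -/
  obtain ⟨t₀, -, ht₀⟩ := isCompact_Icc.exists_isMaxOn (nonempty_Icc.2 (zero_le_one : (0 : ℝ) ≤ 1))
    ((continuous_norm.comp_continuousOn (hδJ.continuous.continuousOn)) : ContinuousOn (fun t ↦ ‖δ t‖) (Icc 0 1))
  set R : ℝ := ‖δ t₀‖ with hR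
  have hRδ : ∀ t, ‖δ t‖ ≤ R := fun t ↦ by
    have h : ‖δ (Int.fract t)‖ ≤ ‖δ t₀‖ := ht₀ (fract_mem_Icc t)
    rwa [periodic_map_fract' hδJ.periodic] at h
  have hRδ' : ∀ t, ‖ζ * δ t‖ ≤ R := fun t ↦ by rw [norm_mul, hζnorm, one_mul]; exact hRδ t
  have hnormR : ‖ζ * δ t₀‖ = R := by rw [norm_mul, hζnorm, one_mul]
  /- Step 5: trichotomy -/
  rcases trichotomy hδJ hδ'J hdisj with hi | hi | ⟨ho, ho'⟩
  · -- `δ` inside `ζ δ`: but `δ t₀` is as far as the farthest point of `ζ δ`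
    have hlt := hδ'J.norm_lt_of_mem_inside hRδ' (hi ⟨t₀, rfl⟩)
    exact (lt_irrefl R) hlt
  · -- `ζ δ` inside `δ`
    have hlt := hδJ.norm_lt_of_mem_inside hRδ (hi ⟨t₀, rfl⟩)
    rw [hnormR] at hlt
    exact (lt_irrefl R) hlt
  · -- mutually exterior: the insides are disjoint, yet both contain `0`
    exact Set.disjoint_left.1 (disjoint_inside_inside hδJ hδ'J ho ho') hδin hδ'in

/-- **A Jordan loop winds `±1` times about every point of its inside.** [folklore] -/
theorem wind_eq_one_or_neg_one_of_mem_inside (h : IsJordanLoop γ) {p : ℂ} (hp : p ∈ inside γ) :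
    wind (fun t ↦ γ t - p) = 1 ∨ wind (fun t ↦ γ t - p) = -1 := by
  -- translate `p` to the origin
  have h₁ : IsJordanLoop (fun t ↦ γ t - p) :=
    ⟨h.continuous.sub continuous_const, fun t ↦ by simp only [h.periodic t],
      fun s hs t ht hst ↦ h.injOn hs ht (sub_left_injective hst)⟩
  set φ : ℂ ≃ₜ ℂ := Homeomorph.addRight (-p) with hφ
  have hφγ : (φ ∘ γ : ℝ → ℂ) = fun t ↦ γ t - p := funext fun t ↦ (sub_eq_add_neg (γ t) p).symm
  have h0 : (0 : ℂ) ∈ inside (fun t ↦ γ t - p) := by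
    have h := (h.mem_inside_comp_homeomorph_iff φ (z := p)).2 hp
    rwa [hφγ, show φ p = 0 from add_neg_cancel p] at h
  exact h₁.wind_eq_one_or_neg_one_of_zero_mem_inside h0

end IsJordanLoop

end Literature.Topology.PlaneTopology
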